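import Literature.MathematicalPhysics.QuantumLattice.AnisotropicXYInfraredBound
import HarnessLib

/-!
# The Kennedy–Lieb–Shastry sum-rule argument for direction-dependent couplings: eq. (7) and the
# long-range-order margin, for an abstract structure factor

Topic `MathematicalPhysics/QuantumLattice`; companion of `AnisotropicXYInfraredBound.lean`,
`AnisotropicXYThermalInfraredBound.lean`, `AnisotropicXYKuboInequality.lean` (the model inputs for
`H_K = -Σ_xΣᵢ Kᵢ(S¹_xS¹_{x+eᵢ} + S²_xS²_{x+eᵢ})`, [KLS1988JSP] eq. (5)) and of the isotropic
assembly `XYOrderProofs.lean` / `XYOrderThermalProofs.lean` (`kls_ineq7`, `kls_thermal_ineq7`,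
`kls_thermal_margin`). No named fact is introduced.

## What is printed, and what is done here

Kennedy–Lieb–Shastry ([KLS1988PRL] eqs. (5)–(8); [KLS1988JSP] eqs. (6)–(9) for couplings
`1, 1, r`) combine the infrared bound `ĝ_q ≤ [numerator/(4E_q)]^{1/2}` (`q ≠ 0`) with the sum rule
weighted by `cos qᵢ` and conclude `ĝ₀/|Λ| > 0` uniformly in the volume once a lattice integral is
small. For direction-dependent couplings `K` the sum rule weighted by `C_K(q) = Σᵢ Kᵢ cos qᵢ` reads
`|Λ|⁻¹Σ_q ĝ_q C_K(q) = Σᵢ Kᵢ e₁^{(i)} =: ē_K` ([KLS1988JSP] eq. (8), direction by direction), and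
with the infrared bound in the Kubo form `ĝ_q ≤ t_q + [ē_K/(2E^K_q)]^{1/2}` (`t_q = 0` in the ground
state, `t_q = 1/(2βE^K_q)` at inverse temperature `β`) the argument of [KLS1988PRL] between
eqs. (4) and (8) gives, on every finite torus,

`ē_K/κ_K ≤ |Λ|⁻¹ĝ₀ + ½ (ē_K/κ_K)^{1/2} R^K_L + (2β)⁻¹ J^K_L`      (`anisoKls_ineq7`),

`κ_K = Σᵢ Kᵢ`, with the punctured Riemann sums `R^K_L = |Λ|⁻¹Σ_{q≠0} F_K(q)`,
`F_K(q) = {C_K(q)}₊ [2/(κ_K E^K_q)]^{1/2}` (`anisoKlsIntegrand`, `anisoKlsRiemannSum`) and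
`J^K_L = |Λ|⁻¹Σ_{q≠0} {C_K(q)}₊/(κ_K E^K_q)` (`anisoKlsThermalSum`). The analytic endgame
([KLS1988PRL], the paragraph after eq. (8); [DLS1978] Thm. 5.1 at `T > 0`) is then model-free:
if eventually `R^K_L ≤ ρ < 2√s` where `s ≤ ē_K/κ_K` (ground state: `s = ½S²` by the variational
bound), the order parameter `2|Λ|⁻¹ĝ₀` has `liminf ≥ 2(s - ½√s ρ₊) > 0` (`anisoKls_margin_ground`);
at positive temperature, with `J^K_L ≤ 𝒯` eventually and `ē_K/κ_K ≥ s - ℓ/β`, the same holds for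
`β ≥ β₀(s, ℓ, ρ, 𝒯)` (`anisoKls_margin_thermal`). For `K ≡ 1` the integrand here is
`{C_q}₊[2/(dE_q)]^{1/2} ≥ F_d(q)` of [KLS1988PRL] eq. (8) (equality at `C_q = d`): the sharper
`(d + C_q)` of the isotropic case uses `|e₃| ≤ e₁` with a direction-independent `e₃`, which has no
analogue for direction-dependent couplings (only `Σᵢ Kᵢ|e₃^{(i)}| ≤ ē_K` is available, see
`AnisotropicXYKuboInequality.lean`).

## References

* [KLS1988PRL] T. Kennedy, E. H. Lieb, B. S. Shastry, Phys. Rev. Lett. 61 (1988) 2582–2584,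
  eqs. (5)–(8) and the paragraph after (8).
* [KLS1988JSP] T. Kennedy, E. H. Lieb, B. S. Shastry, J. Stat. Phys. 53 (1988) 1019–1030,
  eqs. (6)–(9), p. 1020 (positive temperature by the methods of Dyson–Lieb–Simon).
* [DLS1978] F. J. Dyson, E. H. Lieb, B. Simon, J. Stat. Phys. 18 (1978) 335–383, Thm. 5.1.
-/

noncomputable section

open Filter Topology Finset
open Literature.MathematicalPhysics.QuantumLattice Literature.Probability.LatticeModels
  Literature.MathematicalPhysics.QuantumLattice.XYOrderProofs

namespace Literature.MathematicalPhysics.QuantumLattice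

variable {d : ℕ}

/-! ### The weighted cosine sum, the anisotropic KLS integrand and its Riemann sums -/

section Defs

/-- `C_K(p) = Σᵢ Kᵢ cos pᵢ`, the weight of the sum rule for direction-dependent couplings
(`C_K(0) = κ_K = Σᵢ Kᵢ`). [cite: KLS1988JSP, eq. (8)] [cite: KLS1988PRL, eq. (6)] -/
def anisoCosSum (K : Fin d → ℝ) (p : Fin d → ℝ) : ℝ := ∑ i, K i * Real.cos (p i)

/-- The anisotropic KLS integrand `F_K(p) = {C_K(p)}₊ [2/(κ_K E^K_p)]^{1/2}`, `κ_K = Σᵢ Kᵢ`,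
`E^K_p = Σᵢ Kᵢ(1 - cos pᵢ)` (junk value where `E^K_p = 0` through `x/0 = 0`).
[cite: KLS1988PRL, eq. (8)] [cite: KLS1988JSP, eq. (9)] -/
def anisoKlsIntegrand (K : Fin d → ℝ) (p : Fin d → ℝ) : ℝ :=
  max (anisoCosSum K p) 0 * Real.sqrt (2 / ((∑ i, K i) * NVectorAniso.anisoDispersion K p))

/-- The punctured Riemann sum `R^K_L = L^{-d} Σ_{k ≠ 0} F_K(2πk/L)` over the dual torus (junk `0`
at `L = 0`). [cite: KLS1988PRL, eqs. (7)–(8)] [cite: KLS1988JSP, eq. (9)] -/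
def anisoKlsRiemannSum (K : Fin d → ℝ) (L : ℕ) : ℝ :=
  if hL : L = 0 then 0
  else
    haveI : NeZero L := ⟨hL⟩
    (∑ k ∈ (univ : Finset (TorusSite d L)).erase 0, anisoKlsIntegrand K (latticeMomentum L k)) /
      (L : ℝ) ^ d

/-- The thermal companion `J^K_L = L^{-d} Σ_{k ≠ 0} {C_K(2πk/L)}₊/(κ_K E^K_{2πk/L})` (the
`(2β)⁻¹E_p⁻¹` term of the Dyson–Lieb–Simon infrared bound, weighted by the sum rule; junk `0` at
`L = 0`). [cite: DysonLiebSimon1978, Thm. 5.1] [cite: KLS1988JSP, p. 1020] -/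
def anisoKlsThermalSum (K : Fin d → ℝ) (L : ℕ) : ℝ :=
  if hL : L = 0 then 0
  else
    haveI : NeZero L := ⟨hL⟩
    (∑ k ∈ (univ : Finset (TorusSite d L)).erase 0, max (anisoCosSum K (latticeMomentum L k)) 0 /
        ((∑ i, K i) * NVectorAniso.anisoDispersion K (latticeMomentum L k))) / (L : ℝ) ^ d

/-- `C_K(0) = κ_K`. [cite: KLS1988JSP, eq. (8)] -/
theorem anisoCosSum_latticeMomentum_zero (K : Fin d → ℝ) (L : ℕ) :
    anisoCosSum K (latticeMomentum L (0 : TorusSite d L)) = ∑ i, K i := by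
  simp [anisoCosSum, latticeMomentum_apply]

/-- `C_K(p) ≤ κ_K` for `K ≥ 0`. [cite: KLS1988JSP, eq. (8)] -/
theorem anisoCosSum_le {K : Fin d → ℝ} (hK : ∀ i, 0 ≤ K i) (p : Fin d → ℝ) :
    anisoCosSum K p ≤ ∑ i, K i :=
  sum_le_sum fun i _ => by
    have := Real.cos_le_one (p i)
    nlinarith [hK i]

/-- `F_K ≥ 0`. [cite: KLS1988PRL, eq. (8)] -/
theorem anisoKlsIntegrand_nonneg (K : Fin d → ℝ) (p : Fin d → ℝ) : 0 ≤ anisoKlsIntegrand K p :=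
  mul_nonneg (le_max_right _ _) (Real.sqrt_nonneg _)

/-- `R^K_L ≥ 0`. [cite: KLS1988PRL, eq. (8)] -/
theorem anisoKlsRiemannSum_nonneg (K : Fin d → ℝ) (L : ℕ) : 0 ≤ anisoKlsRiemannSum K L := by
  unfold anisoKlsRiemannSum
  split_ifs
  · exact le_rfl
  · exact div_nonneg (sum_nonneg fun _ _ => anisoKlsIntegrand_nonneg _ _) (by positivity)

/-- `J^K_L ≥ 0` for `K ≥ 0`. [cite: DysonLiebSimon1978, Thm. 5.1] -/
theorem anisoKlsThermalSum_nonneg {K : Fin d → ℝ} (hK : ∀ i, 0 ≤ K i) (L : ℕ) :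
    0 ≤ anisoKlsThermalSum K L := by
  unfold anisoKlsThermalSum
  split_ifs
  · exact le_rfl
  · refine div_nonneg (sum_nonneg fun k _ => div_nonneg (le_max_right _ _)
      (mul_nonneg (sum_nonneg fun i _ => hK i) ?_)) (by positivity)
    exact sum_nonneg fun i _ => mul_nonneg (hK i) (sub_nonneg.2 (Real.cos_le_one _))

/-- Unfolding on a genuine torus. [cite: KLS1988PRL, eq. (8)] -/
theorem anisoKlsRiemannSum_of_neZero (K : Fin d → ℝ) (L : ℕ) [NeZero L] :
    anisoKlsRiemannSum K L =
      (∑ k ∈ (univ : Finset (TorusSite d L)).erase 0, anisoKlsIntegrand K (latticeMomentum L k)) /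
        (L : ℝ) ^ d := by
  simp [anisoKlsRiemannSum, NeZero.ne L]

/-- Unfolding on a genuine torus. [cite: DysonLiebSimon1978, Thm. 5.1] -/
theorem anisoKlsThermalSum_of_neZero (K : Fin d → ℝ) (L : ℕ) [NeZero L] :
    anisoKlsThermalSum K L =
      (∑ k ∈ (univ : Finset (TorusSite d L)).erase 0,
        max (anisoCosSum K (latticeMomentum L k)) 0 /
          ((∑ i, K i) * NVectorAniso.anisoDispersion K (latticeMomentum L k))) / (L : ℝ) ^ d := by
  simp [anisoKlsThermalSum, NeZero.ne L]

end Defs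

/-! ### [KLS1988PRL] eq. (7) for direction-dependent couplings, abstract structure factor -/

section Ineq7

/-- The pointwise step: if `0 ≤ g ≤ t + [ē/(2E)]^{1/2}` with `E, κ > 0`, then
`g·C ≤ t{C}₊ + κ·(½ (ē/κ)^{1/2} · {C}₊[2/(κE)]^{1/2})` (`{C}₊ = max C 0`).
[cite: KLS1988PRL, eqs. (5), (7)] -/
theorem anisoKls_pointwise {g t E κ ē C : ℝ} (hg : 0 ≤ g) (hE : 0 < E) (hκ : 0 < κ)
    (hA : g ≤ t + Real.sqrt (ē / (2 * E))) :
    g * C ≤ t * max C 0 +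
      κ * (1 / 2 * Real.sqrt (ē / κ) * (max C 0 * Real.sqrt (2 / (κ * E)))) := by
  have hid : Real.sqrt (ē / (2 * E)) =
      κ / 2 * (Real.sqrt (ē / κ) * Real.sqrt (2 / (κ * E))) := by
    rcases le_or_gt 0 ē with hē | hē
    · rw [← Real.sqrt_mul (div_nonneg hē hκ.le),
        show ē / κ * (2 / (κ * E)) = (2 / κ) ^ 2 * (ē / (2 * E)) by field_simp,
        Real.sqrt_mul (sq_nonneg _), Real.sqrt_sq (by positivity)]
      field_simp
    · have h1 : ē / (2 * E) ≤ 0 := (div_neg_of_neg_of_pos hē (by positivity)).le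
      have h2 : ē / κ ≤ 0 := (div_neg_of_neg_of_pos hē hκ).le
      rw [Real.sqrt_eq_zero'.2 h1, Real.sqrt_eq_zero'.2 h2, zero_mul, mul_zero]
  calc g * C ≤ g * max C 0 := mul_le_mul_of_nonneg_left (le_max_left _ _) hg
    _ ≤ (t + Real.sqrt (ē / (2 * E))) * max C 0 :=
        mul_le_mul_of_nonneg_right hA (le_max_right _ _)
    _ = _ := by rw [hid]; ring

/-- **[KLS1988PRL] eq. (7) for direction-dependent couplings, on the dual torus.** Let `K > 0`
(`d ≥ 1`), `g` and `t` functions on the dual torus of side `L` (a structure factor and the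
thermal term) and `ē` a real with (A) `0 ≤ g_q ≤ t_q + [ē/(2E^K_q)]^{1/2}` for `q ≠ 0` (the
infrared bound in Kubo form) and (C) `|Λ|⁻¹Σ_q g_q C_K(q) = ē` (the weighted sum rule). Then
`ē/κ_K ≤ |Λ|⁻¹g₀ + ½(ē/κ_K)^{1/2} R^K_L + (κ_K|Λ|)⁻¹Σ_{q≠0} t_q{C_K(q)}₊`.
[cite: KLS1988PRL, eq. (7)] [cite: KLS1988JSP, eqs. (8)–(9)] -/
theorem anisoKls_ineq7 (hd : 1 ≤ d) (L : ℕ) [NeZero L] {K : Fin d → ℝ} (hK : ∀ i, 0 < K i)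
    (g t : TorusSite d L → ℝ) {ē : ℝ}
    (hA : ∀ q : TorusSite d L, q ≠ 0 → 0 ≤ g q ∧
      g q ≤ t q + Real.sqrt (ē / (2 * NVectorAniso.anisoDispersion K (latticeMomentum L q))))
    (hC : (∑ q : TorusSite d L, g q * anisoCosSum K (latticeMomentum L q)) / (L : ℝ) ^ d = ē) :
    ē / (∑ i, K i) ≤ g 0 / (L : ℝ) ^ d +
      1 / 2 * Real.sqrt (ē / ∑ i, K i) * anisoKlsRiemannSum K L +
      (∑ q ∈ (univ : Finset (TorusSite d L)).erase 0,
        t q * max (anisoCosSum K (latticeMomentum L q)) 0) / ((∑ i, K i) * (L : ℝ) ^ d) := by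
  set κ : ℝ := ∑ i, K i with hκ_def
  have hκ : 0 < κ := by
    obtain ⟨i⟩ : Nonempty (Fin d) := ⟨⟨0, hd⟩⟩
    exact lt_of_lt_of_le (hK i) (single_le_sum (fun j _ => (hK j).le) (mem_univ i))
  have hL : (0 : ℝ) < (L : ℝ) ^ d := by
    have : (0 : ℝ) < L := by exact_mod_cast Nat.pos_of_ne_zero (NeZero.ne L)
    positivity
  set F : TorusSite d L → ℝ := fun q => anisoKlsIntegrand K (latticeMomentum L q) with hF
  set P : TorusSite d L → ℝ := fun q => max (anisoCosSum K (latticeMomentum L q)) 0 with hP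
  have hsum : ∑ q : TorusSite d L, g q * anisoCosSum K (latticeMomentum L q) ≤
      g 0 * κ + ∑ q ∈ (univ : Finset (TorusSite d L)).erase 0,
        (t q * P q + κ * (1 / 2 * Real.sqrt (ē / κ) * F q)) := by
    rw [← add_sum_erase _ _ (mem_univ (0 : TorusSite d L)), anisoCosSum_latticeMomentum_zero]
    refine add_le_add le_rfl (sum_le_sum fun q hq => ?_)
    have hq0 : q ≠ 0 := (mem_erase.1 hq).1
    obtain ⟨hg, hAq⟩ := hA q hq0
    have h := anisoKls_pointwise (C := anisoCosSum K (latticeMomentum L q)) hg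
      (anisoDispersion_latticeMomentum_pos L hK hq0) hκ hAq
    simp only [hF, hP, anisoKlsIntegrand]
    linarith
  rw [anisoKlsRiemannSum_of_neZero, div_le_iff₀ hκ]
  calc ē = (∑ q : TorusSite d L, g q * anisoCosSum K (latticeMomentum L q)) / (L : ℝ) ^ d :=
        hC.symm
    _ ≤ (g 0 * κ + ∑ q ∈ (univ : Finset (TorusSite d L)).erase 0,
          (t q * P q + κ * (1 / 2 * Real.sqrt (ē / κ) * F q))) / (L : ℝ) ^ d :=
        div_le_div_of_nonneg_right hsum hL.le
    _ = _ := by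
        rw [sum_add_distrib, ← mul_sum, ← mul_sum]
        field_simp
        ring

/-- **Ground-state form** (`t = 0`): (A) `0 ≤ g_q`, `g_q² E^K_q ≤ ½ē` for `q ≠ 0` and (C) give
`ē/κ_K ≤ |Λ|⁻¹g₀ + ½(ē/κ_K)^{1/2} R^K_L`. [cite: KLS1988PRL, eq. (7)] [cite: KLS1988JSP, eq. (9)] -/
theorem anisoKls_ineq7_ground (hd : 1 ≤ d) (L : ℕ) [NeZero L] {K : Fin d → ℝ} (hK : ∀ i, 0 < K i)
    (g : TorusSite d L → ℝ) {ē : ℝ}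
    (hA : ∀ q : TorusSite d L, q ≠ 0 → 0 ≤ g q ∧
      g q ^ 2 * NVectorAniso.anisoDispersion K (latticeMomentum L q) ≤ 1 / 2 * ē)
    (hC : (∑ q : TorusSite d L, g q * anisoCosSum K (latticeMomentum L q)) / (L : ℝ) ^ d = ē) :
    ē / (∑ i, K i) ≤ g 0 / (L : ℝ) ^ d +
      1 / 2 * Real.sqrt (ē / ∑ i, K i) * anisoKlsRiemannSum K L := by
  have hA' : ∀ q : TorusSite d L, q ≠ 0 → 0 ≤ g q ∧
      g q ≤ 0 + Real.sqrt (ē / (2 * NVectorAniso.anisoDispersion K (latticeMomentum L q))) := by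
    intro q hq
    obtain ⟨hg, h⟩ := hA q hq
    have hE := anisoDispersion_latticeMomentum_pos L hK hq
    refine ⟨hg, ?_⟩
    rw [zero_add]
    refine Real.le_sqrt_of_sq_le ?_
    rw [le_div_iff₀ (by positivity)]
    linarith
  have h := anisoKls_ineq7 hd L hK g (fun _ => 0) hA' hC
  simp only [zero_mul, sum_const_zero, zero_div, add_zero] at h
  exact h

/-- **Positive-temperature form** (`t_q = 1/(2βE^K_q)`): (Aᵀ)
`0 ≤ g_q ≤ 1/(2βE^K_q) + ½[2ē/E^K_q]^{1/2}` for `q ≠ 0` and (C) give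
`ē/κ_K ≤ |Λ|⁻¹g₀ + ½(ē/κ_K)^{1/2} R^K_L + (2β)⁻¹ J^K_L`.
[cite: KLS1988PRL, eq. (7)] [cite: DysonLiebSimon1978, Thm. 5.1] [cite: KLS1988JSP, p. 1020] -/
theorem anisoKls_ineq7_thermal (hd : 1 ≤ d) (L : ℕ) [NeZero L] {K : Fin d → ℝ}
    (hK : ∀ i, 0 < K i) {β : ℝ} (hβ : 0 < β) (g : TorusSite d L → ℝ) {ē : ℝ}
    (hA : ∀ q : TorusSite d L, q ≠ 0 → 0 ≤ g q ∧
      g q ≤ 1 / (2 * β * NVectorAniso.anisoDispersion K (latticeMomentum L q)) +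
        1 / 2 * Real.sqrt (2 * ē / NVectorAniso.anisoDispersion K (latticeMomentum L q)))
    (hC : (∑ q : TorusSite d L, g q * anisoCosSum K (latticeMomentum L q)) / (L : ℝ) ^ d = ē) :
    ē / (∑ i, K i) ≤ g 0 / (L : ℝ) ^ d +
      1 / 2 * Real.sqrt (ē / ∑ i, K i) * anisoKlsRiemannSum K L +
      1 / (2 * β) * anisoKlsThermalSum K L := by
  set κ : ℝ := ∑ i, K i with hκ_def
  have hL : (0 : ℝ) < (L : ℝ) ^ d := by
    have : (0 : ℝ) < L := by exact_mod_cast Nat.pos_of_ne_zero (NeZero.ne L)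
    positivity
  -- `½√(2ē/E) = √(ē/(2E))`
  have hhalf : ∀ {E : ℝ}, 0 < E →
      1 / 2 * Real.sqrt (2 * ē / E) = Real.sqrt (ē / (2 * E)) := by
    intro E hE
    rw [show 2 * ē / E = 2 ^ 2 * (ē / (2 * E)) by field_simp,
      Real.sqrt_mul (sq_nonneg _), Real.sqrt_sq (by norm_num)]
    ring
  have hA' : ∀ q : TorusSite d L, q ≠ 0 → 0 ≤ g q ∧
      g q ≤ 1 / (2 * β * NVectorAniso.anisoDispersion K (latticeMomentum L q)) +
        Real.sqrt (ē / (2 * NVectorAniso.anisoDispersion K (latticeMomentum L q))) := by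
    intro q hq
    obtain ⟨hg, h⟩ := hA q hq
    rw [hhalf (anisoDispersion_latticeMomentum_pos L hK hq)] at h
    exact ⟨hg, h⟩
  have h := anisoKls_ineq7 hd L hK g _ hA' hC
  -- identify the thermal term
  have hT : (∑ q ∈ (univ : Finset (TorusSite d L)).erase 0,
      1 / (2 * β * NVectorAniso.anisoDispersion K (latticeMomentum L q)) *
        max (anisoCosSum K (latticeMomentum L q)) 0) / (κ * (L : ℝ) ^ d) =
      1 / (2 * β) * anisoKlsThermalSum K L := by
    rw [anisoKlsThermalSum_of_neZero, ← hκ_def, mul_div_assoc', ← div_div, mul_sum, sum_div]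
    congr 1
    refine sum_congr rfl fun q hq => ?_
    have hE := anisoDispersion_latticeMomentum_pos L hK (mem_erase.1 hq).1
    have hκ : 0 < κ := by
      obtain ⟨i⟩ : Nonempty (Fin d) := ⟨⟨0, hd⟩⟩
      exact lt_of_lt_of_le (hK i) (single_le_sum (fun j _ => (hK j).le) (mem_univ i))
    field_simp
  rw [hT] at h
  exact h

end Ineq7

/-! ### The analytic endgame, for abstract sequences -/

section Margin

/-- `ρ₊ < 2√s` gives the positive margin `c = 2(s - ½√s ρ₊) > 0`.
[cite: KLS1988PRL, after eq. (8)] -/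
theorem anisoKls_margin_pos {s ρ : ℝ} (hs : 0 < s) (hρ : ρ < 2 * Real.sqrt s) :
    0 < 2 * (s - 1 / 2 * Real.sqrt s * max ρ 0) := by
  have hρ' : max ρ 0 < 2 * Real.sqrt s := max_lt hρ (by positivity)
  have h1 : Real.sqrt s * Real.sqrt s = s := Real.mul_self_sqrt hs.le
  have h4 : s - 1 / 2 * Real.sqrt s * max ρ 0 = Real.sqrt s * (Real.sqrt s - max ρ 0 / 2) := by
    rw [mul_sub, h1]; ring
  rw [h4]
  exact mul_pos two_pos (mul_pos (Real.sqrt_pos.2 hs) (by linarith))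

/-- **The ground-state margin** ([KLS1988PRL], after eq. (8): "for any spin `S ≥ ½` … we conclude
from (7) that `m ≠ 0`"), for abstract sequences. Let `s > 0`, `ρ < 2√s`, `R_k ≤ ρ` eventually,
and `a` a real sequence bounded above such that eventually `a_k = 2g_k` with
`e_k ≤ g_k + ½√e_k R_k` (eq. (7)) and `s ≤ e_k` (the variational bound). Then
`liminf a ≥ 2(s - ½√s ρ₊) > 0` (monotonicity of `t ↦ t - ½R√t` on `√t ≥ R/4`,
`kls_monotone_step`). [cite: KLS1988PRL, Theorem and eqs. (7)–(8)] -/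
theorem anisoKls_margin_ground {s ρ M : ℝ} (hs : 0 < s) (hρ : ρ < 2 * Real.sqrt s) {R : ℕ → ℝ}
    (hRρ : ∀ᶠ k : ℕ in atTop, R k ≤ ρ) (a : ℕ → ℝ) (hbd : ∀ k, a k ≤ M)
    (hev : ∀ᶠ k : ℕ in atTop, ∃ e g : ℝ, a k = 2 * g ∧
      e ≤ g + 1 / 2 * Real.sqrt e * R k ∧ s ≤ e) :
    2 * (s - 1 / 2 * Real.sqrt s * max ρ 0) ≤ liminf a atTop ∧
      0 < 2 * (s - 1 / 2 * Real.sqrt s * max ρ 0) := by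
  refine ⟨?_, anisoKls_margin_pos hs hρ⟩
  set ρ' : ℝ := max ρ 0 with hρ'_def
  have hρ'0 : 0 ≤ ρ' := le_max_right _ _
  have hρ'lt : ρ' < 2 * Real.sqrt s := max_lt hρ (by positivity)
  have hRk : ∀ᶠ k : ℕ in atTop, R k ≤ ρ' := hRρ.mono fun k hk => hk.trans (le_max_left _ _)
  have hev' : ∀ᶠ k : ℕ in atTop, 2 * (s - 1 / 2 * Real.sqrt s * ρ') ≤ a k := by
    filter_upwards [hRk, hev] with k hk hevk
    obtain ⟨e, g, hag, h7, hse⟩ := hevk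
    have h4s : R k ≤ 4 * Real.sqrt s := by linarith
    have hmono := kls_monotone_step hs.le hse h4s
    have : 1 / 2 * Real.sqrt s * R k ≤ 1 / 2 * Real.sqrt s * ρ' :=
      mul_le_mul_of_nonneg_left hk (by positivity)
    rw [hag]
    linarith
  exact le_liminf_of_le (isCoboundedUnder_ge_of_le atTop hbd) hev'

/-- **The margin at low temperature** ([KLS1988PRL], end of the paragraph after eq. (8), at
`T > 0`; [DLS1978] Thm. 5.1), for abstract sequences. Let `s > 0`, `ℓ, 𝒯 ≥ 0`, `ρ < 2√s`,
`R_k ≥ 0` with `R_k ≤ ρ` and `T_k ≤ 𝒯` eventually. There is `β₀ > 0` such that for `β ≥ β₀`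
every real sequence `a` bounded above with, eventually, `a_k = 2g_k`,
`e_k ≤ g_k + ½√e_k R_k + T_k/(2β)` (eq. (7) at `T > 0`) and `e_k ≥ s - ℓ/β` (energy–entropy bound)
has `liminf a ≥ s - ½√s ρ₊ > 0` (`β₀ = 1 + 2ℓ/s + 2(2ℓ + 𝒯)/c`, `c = 2(s - ½√sρ₊)`).
[cite: KLS1988PRL, Theorem and eqs. (7)–(8)] [cite: DysonLiebSimon1978, Thm. 5.1] -/
theorem anisoKls_margin_thermal {s ℓ ρ 𝒯 : ℝ} (hs : 0 < s) (hℓ : 0 ≤ ℓ) (hρ : ρ < 2 * Real.sqrt s)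
    (h𝒯 : 0 ≤ 𝒯) {R T : ℕ → ℝ} (hR0 : ∀ k, 0 ≤ R k)
    (hRρ : ∀ᶠ k : ℕ in atTop, R k ≤ ρ) (hT𝒯 : ∀ᶠ k : ℕ in atTop, T k ≤ 𝒯) :
    ∃ β₀ : ℝ, 0 < β₀ ∧ ∀ β : ℝ, β₀ ≤ β → ∀ (M : ℝ) (a : ℕ → ℝ), (∀ k, a k ≤ M) →
      (∀ᶠ k : ℕ in atTop, ∃ e g : ℝ, a k = 2 * g ∧
          e ≤ g + 1 / 2 * Real.sqrt e * R k + 1 / (2 * β) * T k ∧ s - ℓ / β ≤ e) →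
      s - 1 / 2 * Real.sqrt s * max ρ 0 ≤ liminf a atTop ∧
        0 < s - 1 / 2 * Real.sqrt s * max ρ 0 := by
  set ρ' : ℝ := max ρ 0 with hρ'_def
  have hρ'0 : 0 ≤ ρ' := le_max_right _ _
  have hρ'lt : ρ' < 2 * Real.sqrt s := max_lt hρ (by positivity)
  set c : ℝ := 2 * (s - 1 / 2 * Real.sqrt s * ρ') with hc_def
  have hc : 0 < c := anisoKls_margin_pos hs hρ
  set β₀ : ℝ := 1 + 2 * ℓ / s + 2 * (2 * ℓ + 𝒯) / c with hβ₀_def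
  have hβ₀pos : 0 < β₀ := by rw [hβ₀_def]; positivity
  refine ⟨β₀, hβ₀pos, fun β hβ M a hbd hev => ⟨?_, by linarith⟩⟩
  have hβpos : 0 < β := hβ₀pos.trans_le hβ
  -- consequences of `β ≥ β₀`: `ℓ/β ≤ s/2` and `(2ℓ + 𝒯)/β ≤ c/2`
  have hβ1 : 2 * ℓ / s ≤ β := by
    have : (0 : ℝ) ≤ 2 * (2 * ℓ + 𝒯) / c := by positivity
    linarith
  have hβ2 : 2 * (2 * ℓ + 𝒯) / c ≤ β := by
    have : (0 : ℝ) ≤ 2 * ℓ / s := by positivity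
    linarith
  have hℓβ : ℓ / β ≤ s / 2 := by
    rw [div_le_iff₀ hβpos]
    rw [div_le_iff₀ hs] at hβ1
    linarith
  have hτβ : (2 * ℓ + 𝒯) / β ≤ c / 2 := by
    rw [div_le_iff₀ hβpos]
    rw [div_le_iff₀ hc] at hβ2
    linarith
  -- eventually `R_k ≤ ρ'`, `T_k ≤ 𝒯`
  have hRk : ∀ᶠ k : ℕ in atTop, R k ≤ ρ' := hRρ.mono fun k hk => hk.trans (le_max_left _ _)
  have hev' : ∀ᶠ k : ℕ in atTop, c / 2 ≤ a k := by
    filter_upwards [hRk, hT𝒯, hev] with k hk hTk hevk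
    obtain ⟨e, g, hag, h7, hDk⟩ := hevk
    -- the shifted constant `sβ = s - ℓ/β ∈ [s/2, s]`
    obtain ⟨sβ, hsβ_def⟩ : ∃ sβ : ℝ, sβ = s - ℓ / β := ⟨_, rfl⟩
    have hℓβ0 : 0 ≤ ℓ / β := by positivity
    have hsβe : sβ ≤ e := by rw [hsβ_def]; exact hDk
    have hsβs : sβ ≤ s := by rw [hsβ_def]; linarith
    have hsβ2 : s / 2 ≤ sβ := by rw [hsβ_def]; linarith
    have hsβ0 : 0 ≤ sβ := by linarith
    -- `ρ' ≤ 2√s ≤ 4√sβ`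
    have hR4 : R k ≤ 4 * Real.sqrt sβ := by
      have h1 : Real.sqrt s ≤ Real.sqrt (4 * sβ) := Real.sqrt_le_sqrt (by linarith)
      rw [Real.sqrt_mul (by norm_num : (0 : ℝ) ≤ 4),
        show Real.sqrt 4 = 2 by
          rw [show (4 : ℝ) = 2 ^ 2 by norm_num, Real.sqrt_sq (by norm_num)]] at h1
      linarith
    have hmono := kls_monotone_step hsβ0 hsβe hR4
    -- `½ R √sβ ≤ ½ √s ρ'`
    have hRs : 1 / 2 * Real.sqrt sβ * R k ≤ 1 / 2 * Real.sqrt s * ρ' :=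
      mul_le_mul (mul_le_mul_of_nonneg_left (Real.sqrt_le_sqrt hsβs) (by norm_num)) hk (hR0 k)
        (by positivity)
    -- the thermal term
    have hTβ : 1 / (2 * β) * T k ≤ 𝒯 / (2 * β) := by
      rw [one_div_mul_eq_div]
      exact div_le_div_of_nonneg_right hTk (by positivity)
    have key : sβ - 1 / 2 * Real.sqrt sβ * R k - 1 / (2 * β) * T k ≤ g := by
      linarith [h7, hmono]
    have hsplit : (2 * ℓ + 𝒯) / β = 2 * (ℓ / β) + 2 * (𝒯 / (2 * β)) := by
      field_simp
    rw [hag]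
    linarith [key, hRs, hTβ, hτβ, hsβ_def, hc_def, hsplit]
  have hlim : c / 2 ≤ liminf a atTop :=
    le_liminf_of_le (isCoboundedUnder_ge_of_le atTop hbd) hev'
  have : c / 2 = s - 1 / 2 * Real.sqrt s * ρ' := by rw [hc_def]; ring
  linarith

end Margin

end Literature.MathematicalPhysics.QuantumLattice
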